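import Literature.AlgebraicGeometry.Frobenioids.ArithmeticRealificationCoordinates
import Literature.AlgebraicGeometry.Frobenioids.ArithmeticFrobenioidModel
import HarnessLib

/-!
# Frobenioids I, Corollary 5.4 at `C_{K/F}` (row C54-core-arith, sub-row (4), step (D1), toolkit):
# coordinates of prime divisors, real powers and finite products in THE realification `Φ(L)^rlf`

Mochizuki, *The geometry of Frobenioids I: the general theory*, Kyushu J. Math. **62** (2008) 293–400,
Cor. 5.4 p. 104 / Prop. 5.3 p. 103 for the arithmetic Frobenioid of Ex. 6.3 p. 113; Thm. 6.4 (i) p. 115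
("`(Φ^rlf)^gp(L) = ArithDiv_ℝ(L)`"). [cite: MochizukiFrdI2008, Thm. 6.4 (i) p.115]

PROOF-ONLY (cell abc-iut, seat abc-iut-L1-d8; no definitions). For the construction of SMALL REALISATIONS (step (D1)
of the hom-rigidity of `C_{K/F}^un-tr → C_{K/F}^rlf`, hypothesis `hsmall` of
`FrdI.Cor54Sub.rho_linear_eq_arith_of_small`) one builds elements of `Φ(L)^rlf` with prescribed coordinates as
finite products of real powers of the prime divisors `ι[v]`.  In any coordinate system `Θ` as provided by
`ArithRlfCoord.exists_rlfGp_coordinates` (seat abc-iut-L1-d2; `Θ` is only given existentially, so the lemmas take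
its defining properties (a) and (d) as hypotheses):

* `ArithRlfCoord.coord_iota_single` — `Θ[ι[v]] = [v]` (coefficient `1` at the finite place `v`, `0` elsewhere);
* `ArithRlfCoord.coord_rpow` — `Θ[a^r] = r · Θ[a]` for `r ∈ ℝ_{≥0}` (`IsPerfFactorial.Rlf.rpow`);
* `ArithRlfCoord.coord_prod` — `Θ[∏ a_i] = Σ Θ[a_i]`;
* `ArithRlfCoord.coord_prod_rpow_iota` — `Θ[∏_{v ∈ T} ι[v]^{r_v}]_p = Σ_{v ∈ T} r_v · [p = v]`.
Nothing here bears on [IUTchIII] Cor. 3.12.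
-/

noncomputable section

namespace Literature.AlgebraicGeometry.Frobenioids

namespace ArithRlfCoord

open NumberField IsDedekindDomain Literature.IUT.LogVolume

variable {L : Type} [Field L] [NumberField L] (hM : IsPerfFactorial (Multiplicative (EffArithDivisor L)))
  (Θ : Algebra.GrothendieckGroup hM.Rlf →* Multiplicative (ADivisor L))

/-- **`Θ[ι[v]] = [v]`**: in coordinates satisfying (a) of `exists_rlfGp_coordinates`, the image of the prime divisor
`[v] = (single v 1, 0)` has coefficient `1` at `v` and `0` at every other place. [cite: MochizukiFrdI2008, Thm. 6.4 (i) p.115] -/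
theorem coord_iota_single
    (hΘa : ∀ D : EffArithDivisor L,
      Θ (Algebra.GrothendieckGroup.of (hM.toRealification (Perfection.of _ (Multiplicative.ofAdd D)))) =
        Multiplicative.ofAdd (ADivisor.ofArithDivisor L (EffArithDivisor.toArithDivisor L D)))
    (v : HeightOneSpectrum (𝓞 L)) (p : Place L) :
    Multiplicative.toAdd (Θ (Algebra.GrothendieckGroup.of (hM.toRealification (Perfection.of _
      (Multiplicative.ofAdd ((Finsupp.single (FinitePlace.mk v) 1, 0) : EffArithDivisor L)))))) p =
      Finsupp.single (Sum.inr v : Place L) (1 : ℝ) p := by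
  classical
  rw [hΘa, toAdd_ofAdd]
  rcases p with w | v'
  · rw [Finsupp.single_eq_of_ne (by simp)]
    simp only [ADivisor.ofArithDivisor_apply_inl, EffArithDivisor.toArithDivisor_snd, Pi.zero_apply,
      NNReal.coe_zero, mul_zero]
  · simp only [ADivisor.ofArithDivisor_apply_inr, EffArithDivisor.toArithDivisor_fst]
    by_cases hv : v' = v
    · subst hv
      rw [Finsupp.single_eq_same, Finsupp.single_eq_same]
      push_cast
      rfl
    · have hne : FinitePlace.mk v ≠ FinitePlace.mk v' := fun h =>
        hv (by have := congrArg FinitePlace.maximalIdeal h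
               rw [FinitePlace.maximalIdeal_mk, FinitePlace.maximalIdeal_mk] at this
               exact this.symm)
      have hne' : (Sum.inr v : Place L) ≠ Sum.inr v' := fun h => hv (Sum.inr_injective h).symm
      rw [Finsupp.single_eq_of_ne hne.symm, Finsupp.single_eq_of_ne hne'.symm]
      push_cast
      rfl

/-- **`Θ[a^r] = r · Θ[a]`** for the real powers `IsPerfFactorial.Rlf.rpow` (coordinates satisfying (d)).
[cite: MochizukiFrdI2008, Def. 2.4 (i) p.48] -/
theorem coord_rpow
    (hΘd : ∀ (r : ℝ) (ξ : Algebra.GrothendieckGroup hM.Rlf),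
      Θ (IsPerfFactorial.Rlf.realSMul hM r ξ) = Multiplicative.ofAdd (r • Multiplicative.toAdd (Θ ξ)))
    (r : NNReal) (a : hM.Rlf) (p : Place L) :
    Multiplicative.toAdd (Θ (Algebra.GrothendieckGroup.of (IsPerfFactorial.Rlf.rpow hM r a))) p =
      (r : ℝ) * Multiplicative.toAdd (Θ (Algebra.GrothendieckGroup.of a)) p := by
  rw [← IsPerfFactorial.Rlf.realSMul_coe_of, hΘd, toAdd_ofAdd, Finsupp.smul_apply, smul_eq_mul]

/-- **`Θ[∏ a_i] = Σ Θ[a_i]`** (coefficientwise). [cite: MochizukiFrdI2008, Thm. 6.4 (i) p.115] -/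
theorem coord_prod {ι : Type*} (s : Finset ι) (f : ι → hM.Rlf) (p : Place L) :
    Multiplicative.toAdd (Θ (Algebra.GrothendieckGroup.of (∏ i ∈ s, f i))) p =
      ∑ i ∈ s, Multiplicative.toAdd (Θ (Algebra.GrothendieckGroup.of (f i))) p := by
  rw [map_prod, map_prod, toAdd_prod, Finsupp.finsetSum_apply]

/-- **`Θ[∏_{v ∈ T} ι[v]^{r_v}]_p = Σ_{v ∈ T} r_v · [p = v]`**: coordinates of a finite product of real powers of
prime divisors. [cite: MochizukiFrdI2008, Thm. 6.4 (i) p.115] -/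
theorem coord_prod_rpow_iota
    (hΘa : ∀ D : EffArithDivisor L,
      Θ (Algebra.GrothendieckGroup.of (hM.toRealification (Perfection.of _ (Multiplicative.ofAdd D)))) =
        Multiplicative.ofAdd (ADivisor.ofArithDivisor L (EffArithDivisor.toArithDivisor L D)))
    (hΘd : ∀ (r : ℝ) (ξ : Algebra.GrothendieckGroup hM.Rlf),
      Θ (IsPerfFactorial.Rlf.realSMul hM r ξ) = Multiplicative.ofAdd (r • Multiplicative.toAdd (Θ ξ)))
    (T : Finset (HeightOneSpectrum (𝓞 L))) (r : HeightOneSpectrum (𝓞 L) → NNReal) (p : Place L) :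
    Multiplicative.toAdd (Θ (Algebra.GrothendieckGroup.of (∏ v ∈ T, IsPerfFactorial.Rlf.rpow hM (r v)
      (hM.toRealification (Perfection.of _
        (Multiplicative.ofAdd ((Finsupp.single (FinitePlace.mk v) 1, 0) : EffArithDivisor L))))))) p =
      ∑ v ∈ T, (r v : ℝ) * Finsupp.single (Sum.inr v : Place L) (1 : ℝ) p := by
  rw [coord_prod]
  refine Finset.sum_congr rfl fun v _ => ?_
  rw [coord_rpow hM Θ hΘd, coord_iota_single hM Θ hΘa]

end ArithRlfCoord

end Literature.AlgebraicGeometry.Frobenioids
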